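import Summits.CriticalPhenomena.PercolationContinuityZ3.Theorems.PercNearOneGluingNoHeavyLowerTailKnQuestion8PocketCertificate
import Summits.CriticalPhenomena.PercolationContinuityZ3.Theorems.PercNearOneGluingNoHeavyLowerTailKnQuestion8PocketAttach
import HarnessLib

/-!
# KN Question 8 / MC-D at three relays — the scalar mass-ratio inequality (T1) of the pocket certificate, every pocket family

Support file (`--supports stmt-CriticalPhenomena-4575`, closed), prover `prim-lf-2` (gen 17).  No definitions, no named facts, no sorries;
standard axioms.  Memo `prim-lf-2/POCKET-SETDUAL-gen17.md` §7.3.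

In the telescoping of the pocket covariance comparison PCOV over the worlds `W = C_z` (memo §4, §7.3) the per-world remainder is
`R_W = ν(P)·(c₂ A_W − b C_W) − (c₂ ν(O) − b ν(P∩Y))·B_W` with `B_W = Cov_W(G, 1_P) ≤ 0`, so PCOV reduces to the two-covariance statement AR2
and the SCALAR inequality (T1) `c₂·m_O ≥ b·m_F`, i.e.
  `μ(o↔y, y↮x, y↮z) · μ(C_o∈𝒟, x↔y, x↮z) ≤ μ(C_o∈𝒟, y↮x, y↮z) · μ(o∈C x, x↮z)`
(prim-lf-2 gen 17 census: 731/731).  THIS FILE proves (T1) for every down-closed pocket family `𝒟` none of whose members contains `z`: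
* `PocketCert.pocket_mass_ratio_core` — the sharper `μ(o↔y, y↮x, y↮z)·μ(P, x↔y, x↮z) ≤ μ(P, y↮x, y↮z)·μ(o↔y, y↔x, y↮z)`: after adding
  `μ(o↔y,y↔x,y↮z)·μ(P,x↔y,x↮z)` to both sides it is `PocketCert.attach_of_pocket` for the owner `y`, the observer `o`, the single avoided vertex
  `z` and the monotone functional `1{x ∈ ·}` — "`x ∈ C_y` is likelier given `o ∈ C_y` than given `o` in a pocket" (vdBHK Thm 2.1, `S = {y,o}`, `T = {z}`);
* `PocketCert.pocket_mass_ratio` — (T1), since `{o↔y, y↔x, y↮z} ⊆ {o∈C x, x↮z}`.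
[cite: VandenbergHaggstromKahn2005, Thm. 2.1 (p. 9)] [cite: KozmaNitzan2024, Questions 8–9 (§5.5 p. 36)]
-/

namespace Summit.CriticalPhenomena.PercolationContinuityZ3.Theorems

open MeasureTheory Set Literature.Probability.LatticeModels Literature.Probability.Percolation
open scoped Classical
open KNPreFKG

noncomputable section

namespace PocketCert

variable {V : Type*} [Fintype V]

/-- **(T1), sharp form.**  `𝒟` down-closed with `z` in no member, `P = {C_o ∈ 𝒟}`:
`μ({y↔o} ∩ {y↮x} ∩ {y↮z}) · μ(P ∩ ({x↔y} ∩ {x↮z})) ≤ μ(P ∩ ({y↮x} ∩ {y↮z})) · μ({y↔o} ∩ {y↔x} ∩ {y↮z})`.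
[cite: VandenbergHaggstromKahn2005, Thm. 2.1 (p. 9)] -/
theorem pocket_mass_ratio_core (w : Sym2 V → unitInterval) (o x y z : V) (𝒟 : Set (Set V)) (h𝒟 : IsLowerSet 𝒟)
    (hz : ∀ W ∈ 𝒟, z ∉ W) :
    (prodBernoulli w).real (openConn y o ∩ {ω | ¬ (openGraph ω).Reachable y x} ∩ {ω | ¬ (openGraph ω).Reachable y z}) *
        (prodBernoulli w).real ({ω : BondConfig V | openCluster ω o ∈ 𝒟} ∩ (openConn x y ∩ {ω | ¬ (openGraph ω).Reachable x z})) ≤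
      (prodBernoulli w).real ({ω : BondConfig V | openCluster ω o ∈ 𝒟} ∩
          ({ω | ¬ (openGraph ω).Reachable y x} ∩ {ω | ¬ (openGraph ω).Reachable y z})) *
        (prodBernoulli w).real (openConn y o ∩ openConn y x ∩ {ω | ¬ (openGraph ω).Reachable y z}) := by
  classical
  set μ := prodBernoulli w with hμ
  have hmeas : ∀ S : Set (BondConfig V), MeasurableSet S := fun _ => MeasurableSet.of_discrete
  have hn := fun (S : Set (BondConfig V)) => (measureReal_nonneg : 0 ≤ μ.real S)
  set F : Set V → ℝ := fun T => T.indicator (1 : V → ℝ) x with hF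
  have hFmono : ∀ S T : Set V, S ⊆ T → F S ≤ F T := fun S T hST =>
    Set.indicator_le_indicator_of_subset hST (fun _ => zero_le_one) x
  have hI : ∀ (S : Set (BondConfig V)), ∫ ω in S, F (openCluster ω y) ∂μ = μ.real (S ∩ openConn y x) :=
    fun S => setIntegral_indicator_openCluster μ x y S
  -- attach_of_pocket for the owner `y`, observer `o`, avoided vertex `z` (twice), functional `1{x ∈ ·}`
  have h := attach_of_pocket w o y z z 𝒟 h𝒟 hz hz F hFmono
  rw [hI, hI, inter_self] at h
  set P : Set (BondConfig V) := {ω : BondConfig V | openCluster ω o ∈ 𝒟} with hP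
  set Dz : Set (BondConfig V) := {ω : BondConfig V | ¬ (openGraph ω).Reachable y z} with hDz
  -- h : μ(yo ∩ Dz ∩ Dz) * μ(P ∩ Dz ∩ yx) ≤ μ(P ∩ Dz) * μ(yo ∩ Dz ∩ Dz ∩ yx)
  have e0 : openConn y o ∩ Dz ∩ Dz = openConn y o ∩ Dz := by rw [inter_assoc, inter_self]
  rw [e0] at h
  -- split `{y↔o} ∩ Dz` and `P ∩ Dz` along `{y↔x}`
  have s1 : μ.real (openConn y o ∩ Dz) =
      μ.real (openConn y o ∩ {ω | ¬ (openGraph ω).Reachable y x} ∩ Dz) + μ.real (openConn y o ∩ Dz ∩ openConn y x) := by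
    rw [← measureReal_inter_add_sdiff₀ (s := openConn y o ∩ Dz) (t := openConn y x) (hmeas _).nullMeasurableSet, add_comm]
    congr 2
    ext ω; simp only [mem_sdiff, mem_inter_iff, mem_setOf_eq, openConn]; tauto
  have s2 : μ.real (P ∩ Dz) =
      μ.real (P ∩ ({ω | ¬ (openGraph ω).Reachable y x} ∩ Dz)) + μ.real (P ∩ Dz ∩ openConn y x) := by
    rw [← measureReal_inter_add_sdiff₀ (s := P ∩ Dz) (t := openConn y x) (hmeas _).nullMeasurableSet, add_comm]
    congr 2
    ext ω; simp only [mem_sdiff, mem_inter_iff, mem_setOf_eq, openConn]; tauto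
  -- identify the cells with the statement's events
  have e1 : P ∩ Dz ∩ openConn y x = P ∩ (openConn x y ∩ {ω | ¬ (openGraph ω).Reachable x z}) := by
    ext ω
    simp only [hDz, mem_inter_iff, mem_setOf_eq, openConn]
    constructor
    · rintro ⟨⟨hP', hyz⟩, hyx⟩
      exact ⟨hP', hyx.symm, fun hxz => hyz (hyx.trans hxz)⟩
    · rintro ⟨hP', hxy, hxz⟩
      exact ⟨⟨hP', fun hyz => hxz (hxy.trans hyz)⟩, hxy.symm⟩
  have e2 : openConn y o ∩ Dz ∩ openConn y x = openConn y o ∩ openConn y x ∩ Dz := by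
    ext ω; simp only [mem_inter_iff]; tauto
  rw [s1, s2, e1, e2] at h
  change (μ.real (openConn y o ∩ {ω | ¬ (openGraph ω).Reachable y x} ∩ Dz) +
      μ.real (openConn y o ∩ openConn y x ∩ Dz)) *
      μ.real (P ∩ (openConn x y ∩ {ω | ¬ (openGraph ω).Reachable x z})) ≤
    (μ.real (P ∩ ({ω | ¬ (openGraph ω).Reachable y x} ∩ Dz)) + μ.real (P ∩ (openConn x y ∩ {ω | ¬ (openGraph ω).Reachable x z}))) *
      μ.real (openConn y o ∩ openConn y x ∩ Dz) at h
  nlinarith [h, hn (openConn y o ∩ openConn y x ∩ Dz), hn (P ∩ (openConn x y ∩ {ω | ¬ (openGraph ω).Reachable x z}))]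

/-- **(T1).**  `𝒟` down-closed with `z` in no member, `P = {C_o ∈ 𝒟}`:
`μ({y↔o} ∩ {y↮x} ∩ {y↮z}) · μ(P ∩ ({x↔y} ∩ {x↮z})) ≤ μ(P ∩ ({y↮x} ∩ {y↮z})) · μ({x↔o} ∩ {x↮z})`
(in the certificate's notation `b · m_F ≤ c₂ · m_O`).
[cite: VandenbergHaggstromKahn2005, Thm. 2.1 (p. 9)] [cite: KozmaNitzan2024, Questions 8–9 (§5.5 p. 36)] -/
theorem pocket_mass_ratio (w : Sym2 V → unitInterval) (o x y z : V) (𝒟 : Set (Set V)) (h𝒟 : IsLowerSet 𝒟)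
    (hz : ∀ W ∈ 𝒟, z ∉ W) :
    (prodBernoulli w).real (openConn y o ∩ {ω | ¬ (openGraph ω).Reachable y x} ∩ {ω | ¬ (openGraph ω).Reachable y z}) *
        (prodBernoulli w).real ({ω : BondConfig V | openCluster ω o ∈ 𝒟} ∩ (openConn x y ∩ {ω | ¬ (openGraph ω).Reachable x z})) ≤
      (prodBernoulli w).real ({ω : BondConfig V | openCluster ω o ∈ 𝒟} ∩
          ({ω | ¬ (openGraph ω).Reachable y x} ∩ {ω | ¬ (openGraph ω).Reachable y z})) *
        (prodBernoulli w).real (openConn x o ∩ {ω | ¬ (openGraph ω).Reachable x z}) := by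
  have h := pocket_mass_ratio_core w o x y z 𝒟 h𝒟 hz
  have hsub : openConn y o ∩ openConn y x ∩ {ω | ¬ (openGraph ω).Reachable y z} ⊆
      openConn x o ∩ {ω : BondConfig V | ¬ (openGraph ω).Reachable x z} := by
    rintro ω ⟨⟨hyo, hyx⟩, hyz⟩
    exact ⟨hyx.symm.trans hyo, fun hxz => hyz (hyx.trans hxz)⟩
  have hmono := measureReal_mono (μ := prodBernoulli w) hsub
  exact h.trans (mul_le_mul_of_nonneg_left hmono measureReal_nonneg)

end PocketCert

end

end Summit.CriticalPhenomena.PercolationContinuityZ3.Theorems
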